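import Literature.AlgebraicGeometry.AbelianSchemes.PoincareSheafMulNKernel
import HarnessLib

/-!
# Points of `Â` with the same `(π × 1)^*𝒫`-class agree after `[n]` — the `hTors` input of the (K) assembly

Layer `Literature/AlgebraicGeometry/AbelianSchemes`, namespace `Literature.AlgebraicGeometry.AbelianSchemes.AbelianSchemeOver.DualPair`.
Cell `hodgecm-mathlib`, HECKE-LINK brick H2 file (ii), D6 (u4), (K)/(u4) plan of record (B-plan1 (g14) 21:39:01Z): the hypothesis
`hTors` of B-p09 (g10)'s assembly `stabilizer_le_of_torsion_of_character` (`AbelianSchemes/PoincarePullbackStabilizerConstant`),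
VERBATIM, for `N := (π × 1_Â)^*𝒫`.  THEOREMS ONLY; over ★ (K1)+(K2) `PoincareSheafMulNKernel` (hence ★ (SYM-n), ★ (P-⊗)).

Setting: `A/S` an abelian scheme over a reduced locally Noetherian base, `D = (Â, 𝒫)` a dual pair with the unit hypothesis `hD`,
`X/S` an abelian scheme with homomorphisms `ψ : A → X`, `π : X → A`, `ψ ≫ π = [n]_A` (two-step descent: `X = A/K`), and the family
`N := (π × 1_Â)^*𝒫` on `X ×_S Â`.

* §1 `baseChangeToProd_comp_whiskerRight_left` — the square `(1_X × a) ≫ (π × 1_Â) = π_T ≫ (1_A × a)`, so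
  `(1_X × a)^*N ≅ π_T^*((1_A × a)^*𝒫)` (`nonempty_pullback_baseChangeToProd_whiskerRight_iso`);
* §2 **`comp_pow_id_left_eq_of_nonempty_pullback_iso`** (= `hTors`): for `T`-valued points `a, a′ : T → Â` over `f`,
  `(1_X × a)^*N ≅ (1_X × a′)^*N ⟹ a ≫ [n]_Â = a′ ≫ [n]_Â` — by ★ (K1) `π_T^*𝒫_{a a′⁻¹} ≅ 𝒪`, ★ (K2) `(a a′⁻¹)ⁿ = 1`, and
  commutativity of `Â` ([MumfordFogartyKirwan1994] Cor. 6.5).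

HC_CM is proved only modulo the 7 printed citations until rung 0 closes; nothing here is about HC.

## References
* [MumfordAV1970] D. Mumford, *Abelian Varieties* (1970), §15 Thm. 1 (p. 143) (`ker f̂ = (ker f)^D ⊆ Â[n]`).
* [MilneAV2008] J. S. Milne, *Abelian Varieties* (v2.00, 2008), I §8 pp. 36–37, I §9.
* [MumfordFogartyKirwan1994] D. Mumford, J. Fogarty, F. Kirwan, *Geometric Invariant Theory*, 3rd ed. (1994), Ch. 6 §1 Cor. 6.5
  (p. 117), Ch. 7 §2 Definition 7.1 (ii) (p. 129).
-/

noncomputable section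

universe u

open CategoryTheory CategoryTheory.Limits AlgebraicGeometry MonoidalCategory CartesianMonoidalCategory
open scoped MonObj

-- `Scheme.Modules` / `SheafOfModules` are not reducible (as in Mathlib's `AlgebraicGeometry/Modules/Sheaf.lean`).
set_option backward.isDefEq.respectTransparency false

namespace Literature.AlgebraicGeometry.AbelianSchemes

namespace AbelianSchemeOver

open Literature.AlgebraicGeometry.Motives Literature.AlgebraicGeometry.AbelianVarieties
  Literature.AlgebraicGeometry.Modules

variable {S : Scheme.{u}} (X A B : AbelianSchemeOver S)

/-! ## §1 The square `(1_X × a) ≫ (π × 1) = π_T ≫ (1_A × a)` -/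

/-- **`(1_X × a) ≫ (π × 1_B) = π_T ≫ (1_A × a)`** as morphisms `X_T → A ×_S B`, for an `S`-morphism `π : X → A` and a `T`-valued point
`a : T → B` over `f` (`π_T = (π)_T` the base change, ★ `baseChangeHom`). [cite: MilneAV2008, I §8 pp. 36–37] -/
theorem baseChangeToProd_comp_whiskerRight_left (π : X.X ⟶ A.X) {T : Scheme.{u}} (f : T ⟶ S) (a : T ⟶ B.X.left)
    (ha : a ≫ B.X.hom = f) :
    X.baseChangeToProd B f a ha ≫ (π ▷ B.X).left = (baseChangeHom π f).left ≫ A.baseChangeToProd B f a ha := by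
  have hw : (baseChangeHom π f).left ≫ pullback.snd A.X.hom f = pullback.snd X.X.hom f := Over.w _
  apply pullback.hom_ext
  · calc (X.baseChangeToProd B f a ha ≫ (π ▷ B.X).left) ≫ pullback.fst A.X.hom B.X.hom
          = X.baseChangeToProd B f a ha ≫ ((π ▷ B.X) ≫ fst A.X B.X).left := rfl
      _ = X.baseChangeToProd B f a ha ≫ (fst X.X B.X ≫ π).left := by rw [whiskerRight_fst]
      _ = (X.baseChangeToProd B f a ha ≫ pullback.fst X.X.hom B.X.hom) ≫ π.left := (Category.assoc _ _ _).symm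
      _ = pullback.fst X.X.hom f ≫ π.left := by rw [baseChangeToProd_fst]
      _ = (baseChangeHom π f).left ≫ pullback.fst A.X.hom f := (baseChangeHom_left_comp_fst π f).symm
      _ = ((baseChangeHom π f).left ≫ A.baseChangeToProd B f a ha) ≫ pullback.fst A.X.hom B.X.hom := by
          rw [Category.assoc, baseChangeToProd_fst]
  · calc (X.baseChangeToProd B f a ha ≫ (π ▷ B.X).left) ≫ pullback.snd A.X.hom B.X.hom
          = X.baseChangeToProd B f a ha ≫ ((π ▷ B.X) ≫ snd A.X B.X).left := rfl
      _ = X.baseChangeToProd B f a ha ≫ (snd X.X B.X).left := by rw [whiskerRight_snd]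
      _ = pullback.snd X.X.hom f ≫ a := X.baseChangeToProd_snd B f a ha
      _ = ((baseChangeHom π f).left ≫ pullback.snd A.X.hom f) ≫ a := by rw [hw]
      _ = ((baseChangeHom π f).left ≫ A.baseChangeToProd B f a ha) ≫ pullback.snd A.X.hom B.X.hom := by
          rw [Category.assoc, Category.assoc, baseChangeToProd_snd]

variable {X A B}

namespace DualPair

variable (D : A.DualPair) (π : X.X ⟶ A.X) {T : Scheme.{u}} (f : T ⟶ S)

/-- **`(1_X × a)^*((π × 1_Â)^*𝒫) ≅ π_T^*((1_A × a)^*𝒫)`** (§1). [cite: MilneAV2008, I §8 pp. 36–37] -/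
theorem nonempty_pullback_baseChangeToProd_whiskerRight_iso (a : T ⟶ D.hat.X.left) (ha : a ≫ D.hat.X.hom = f) :
    Nonempty ((Scheme.Modules.pullback (X.baseChangeToProd D.hat f a ha)).obj
        ((Scheme.Modules.pullback (π ▷ D.hat.X).left).obj D.P) ≅
      (Scheme.Modules.pullback (baseChangeHom π f).left).obj (D.pullbackP f a ha)) :=
  ⟨(Scheme.Modules.pullbackComp _ _).app D.P ≪≫
    (Scheme.Modules.pullbackCongr (X.baseChangeToProd_comp_whiskerRight_left A D.hat π f a ha)).app D.P ≪≫
    ((Scheme.Modules.pullbackComp _ _).app D.P).symm⟩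

/-! ## §2 `hTors` -/

variable [IsReduced S] [IsLocallyNoetherian S]

/-- **`hTors` for `N := (π × 1_Â)^*𝒫`** (the (K1)+(K2) hypothesis of ★ B-p09 (g10)'s `stabilizer_le_of_torsion_of_character`,
verbatim): for `S` reduced and locally Noetherian, the unit hypothesis `hD`, homomorphisms `ψ : A → X`, `π : X → A` with
`ψ ≫ π = [n]_A`, and `T`-valued points `a, a′ : T → Â` over `f`: if `(1_X × a)^*N ≅ (1_X × a′)^*N` then `a ≫ [n]_Â = a′ ≫ [n]_Â`.
Proof: `π_T^*𝒫_a ≅ π_T^*𝒫_{a′}` (§1) ⇒ `π_T^*𝒫_{a a′⁻¹} ≅ 𝒪` (★ (K1)) ⇒ `(a a′⁻¹)ⁿ = 1` (★ (K2), through `ψ ≫ π = [n]_A`) ⇒ `aⁿ = a′ⁿ`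
(`Â` is commutative over a reduced base, ★ `isCommMonObj_of_isReduced_base`) ⇒ `a ≫ [n] = a′ ≫ [n]` (Mathlib `MonObj.comp_pow`).
[cite: MumfordAV1970, §15 Thm. 1 (p. 143)] [cite: MumfordFogartyKirwan1994, Ch. 6 §1 Cor. 6.5 (p. 117) and Ch. 7 §2 Definition 7.1 (ii) (p. 129)] -/
theorem comp_pow_id_left_eq_of_nonempty_pullback_iso
    (hD : Nonempty ((Scheme.Modules.pullback (unitHatSlice D)).obj D.P ≅ SheafOfModules.unit _))
    (ψ : A.X ⟶ X.X) (n : ℕ) (hψπ : ψ ≫ π = A.mulN n) (a a' : T ⟶ D.hat.X.left) (ha : a ≫ D.hat.X.hom = f)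
    (ha' : a' ≫ D.hat.X.hom = f)
    (h : Nonempty ((Scheme.Modules.pullback (X.baseChangeToProd D.hat f a ha)).obj
        ((Scheme.Modules.pullback (π ▷ D.hat.X).left).obj D.P) ≅
      (Scheme.Modules.pullback (X.baseChangeToProd D.hat f a' ha')).obj
        ((Scheme.Modules.pullback (π ▷ D.hat.X).left).obj D.P))) :
    a ≫ (((𝟙 D.hat.X : D.hat.X ⟶ D.hat.X) ^ n : D.hat.X ⟶ D.hat.X)).left =
      a' ≫ (((𝟙 D.hat.X : D.hat.X ⟶ D.hat.X) ^ n : D.hat.X ⟶ D.hat.X)).left := by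
  haveI : IsCommMonObj D.hat.X := D.hat.isCommMonObj_of_isReduced_base
  -- the two points as morphisms `Over.mk f ⟶ Â`
  set p : Over.mk f ⟶ D.hat.X := Over.homMk a ha with hp
  set p' : Over.mk f ⟶ D.hat.X := Over.homMk a' ha' with hp'
  obtain ⟨e⟩ := h
  obtain ⟨e₁⟩ := D.nonempty_pullback_baseChangeToProd_whiskerRight_iso π f a ha
  obtain ⟨e₂⟩ := D.nonempty_pullback_baseChangeToProd_whiskerRight_iso π f a' ha'
  -- (K1): `π_T^*𝒫_{p p′⁻¹} ≅ 𝒪`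
  obtain ⟨j⟩ := D.nonempty_pullback_pullbackP_mul_inv_iso_unit f hD p p' (baseChangeHom π f).left
    ⟨e₁.symm ≪≫ e ≪≫ e₂⟩
  -- (K2): `(p p′⁻¹)ⁿ = 1`
  have htor : (p * p'⁻¹) ^ n = 1 :=
    D.pow_eq_one_of_nonempty_pullback_factor_iso_unit f hD (p * p'⁻¹) n ψ π hψπ ⟨j⟩
  -- `pⁿ = p′ⁿ` in the commutative group of `T`-valued points
  have hpow : p ^ n = p' ^ n := by
    rw [mul_pow, inv_pow, mul_inv_eq_one] at htor
    exact htor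
  have h1 : p ^ n = p ≫ ((𝟙 D.hat.X : D.hat.X ⟶ D.hat.X) ^ n) := by rw [MonObj.comp_pow, Category.comp_id]
  have h2 : p' ^ n = p' ≫ ((𝟙 D.hat.X : D.hat.X ⟶ D.hat.X) ^ n) := by rw [MonObj.comp_pow, Category.comp_id]
  rw [h1, h2] at hpow
  have key := congrArg Over.Hom.left hpow
  rw [Over.comp_left, Over.comp_left] at key
  exact key

end DualPair

end AbelianSchemeOver

end Literature.AlgebraicGeometry.AbelianSchemes

end
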